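import Literature.Dynamics.Ergodic.KolmogorovSinaiEntropyDynamic

/-!
# Kolmogorov–Sinai entropy: `h(T, ⋁_{i<k} T^{-i}ξ) = h(T, ξ)`, `h(Tᵏ) = k h(T)`, conjugacy

Companion to `Literature/Dynamics/Ergodic/KolmogorovSinaiEntropy.lean` (definitions and
conventions there). Everything in this file is PROVED, for a probability space `(Ω, μ)` and a
measure-preserving `T` (`MeasurePreserving T μ μ`):

* **Walters Thm 4.12 (vi)** `dynEntropy_itinerary`: `h(T, ⋁_{i<k} T^{-i}ξ) = h(T, ξ)` (`k ≥ 1`);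
* `dynEntropy_id`: `h(id, ξ) = 0` (Walters, Remark (2) after Def 4.10: `h(id_X) = 0`);
* `dynEntropy_iterate_itinerary`: `h(Tᵏ, ⋁_{i<k} T^{-i}ξ) = k h(T, ξ)` (first display in the
  proof of Walters Thm 4.13) and **Walters Thm 4.13 (i)** `kolmogorovSinaiEntropy_iterate`:
  `h(Tᵏ) = k h(T)` (all `k : ℕ`; `k = 0` is `h(id) = 0`);
* **Walters Thm 4.11 / Downarowicz Fact 4.1.3** for point (semi)conjugacies:
  if `φ : (Ω, μ) → (Ω', μ')` is measure-preserving with `φ ∘ T = T' ∘ φ` then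
  `h_μ(T, ξ' ∘ φ) = h_{μ'}(T', ξ')` (`dynEntropy_comp_of_semiconj`), hence a factor has no more
  entropy, `h(T') ≤ h(T)` (`kolmogorovSinaiEntropy_le_of_semiconj`), and conjugate systems
  (semiconjugacies both ways) have equal entropy (`kolmogorovSinaiEntropy_eq_of_semiconj`).
  Walters proves 4.11 for isomorphisms of measure algebras; the point-map version here is the
  one of Downarowicz Fact 4.1.3.

The combinatorial inputs are identities between itineraries: `⋁_{j<n} T^{-j}(⋁_{i<k} T^{-i}ξ)`
is a coarsening of `⋁_{i<n+k} T^{-i}ξ` and refines `⋁_{i<n} T^{-i}ξ`; `⋁_{j<n} T^{-kj}(⋁_{i<k}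
T^{-i}ξ)` and `⋁_{i<nk} T^{-i}ξ` coarsen each other (Euclidean division of the time index).

## References
* P. Walters, *An Introduction to Ergodic Theory*, GTM 79, Springer 1982, Thms 4.11–4.13.
* T. Downarowicz, *Entropy in Dynamical Systems*, CUP 2011, Fact 4.1.3.
-/

noncomputable section

open MeasureTheory Filter Topology Function Real
open scoped ENNReal

namespace Literature.Dynamics.Ergodic

variable {Ω Ω' α β : Type*}

/-! ### More algebra of itineraries -/

section ItineraryAlgebra

variable (T : Ω → Ω) (ξ : Ω → α)

/-- The identity map produces constant itineraries: `⋁_{i<n} id^{-i} ξ` is `ξ` relabelled.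
[cite: Walters1982, §4.4 Remark (2) after Def 4.10] -/
theorem itinerary_id (n : ℕ) : itinerary id ξ n = (fun (a : α) (_ : Fin n) => a) ∘ ξ := by
  funext ω i
  simp only [itinerary_apply, iterate_id, id_eq, comp_apply]

/-- `⋁_{j<n} T^{-j}(⋁_{i<k} T^{-i}ξ)` is a coarsening of `⋁_{l<n+k} T^{-l}ξ` (read off the entries
`l = i + j`). [cite: Walters1982, Thm 4.12 (vi) (proof)] -/
theorem itinerary_itinerary_eq_comp (k n : ℕ) :
    itinerary T (itinerary T ξ k) n =
      (fun (w : Fin (n + k) → α) (j : Fin n) (i : Fin k) =>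
        w ⟨i + j, by omega⟩) ∘ itinerary T ξ (n + k) := by
  funext ω j i
  simp only [itinerary_apply, comp_apply, ← iterate_add_apply]

/-- `⋁_{j<n} T^{-j}ξ` is a coarsening of `⋁_{j<n} T^{-j}(⋁_{i<k+1} T^{-i}ξ)` (entry `i = 0`).
[cite: Walters1982, Thm 4.12 (vi) (proof)] -/
theorem itinerary_eq_comp_itinerary_itinerary (k n : ℕ) :
    itinerary T ξ n =
      (fun (v : Fin n → Fin (k + 1) → α) (j : Fin n) => v j 0) ∘
        itinerary T (itinerary T ξ (k + 1)) n := by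
  funext ω j
  simp only [itinerary_apply, comp_apply, Fin.val_zero, iterate_zero, id_eq]

/-- `⋁_{j<n} T^{-kj}(⋁_{i<k} T^{-i}ξ)` is a coarsening of `⋁_{l<nk} T^{-l}ξ` (`l = i + k j`).
[cite: Walters1982, Thm 4.13 (i) (proof)] -/
theorem itinerary_iterate_itinerary_eq_comp (k n : ℕ) :
    itinerary T^[k] (itinerary T ξ k) n =
      (fun (w : Fin (n * k) → α) (j : Fin n) (i : Fin k) =>
        w ⟨i + k * j, by nlinarith [i.isLt, j.isLt]⟩) ∘ itinerary T ξ (n * k) := by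
  funext ω j i
  simp only [itinerary_apply, comp_apply, ← iterate_mul, ← iterate_add_apply]

/-- `⋁_{l<nk} T^{-l}ξ` is a coarsening of `⋁_{j<n} T^{-kj}(⋁_{i<k} T^{-i}ξ)` (`j = l / k`,
`i = l % k`). [cite: Walters1982, Thm 4.13 (i) (proof)] -/
theorem itinerary_mul_eq_comp {k : ℕ} (hk : 0 < k) (n : ℕ) :
    itinerary T ξ (n * k) =
      (fun (v : Fin n → Fin k → α) (l : Fin (n * k)) =>
        v ⟨l / k, (Nat.div_lt_iff_lt_mul hk).2 l.isLt⟩ ⟨l % k, Nat.mod_lt _ hk⟩) ∘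
        itinerary T^[k] (itinerary T ξ k) n := by
  funext ω l
  simp only [itinerary_apply, comp_apply, ← iterate_mul, ← iterate_add_apply, Nat.mod_add_div]

/-- Itineraries along a semiconjugacy `φ ∘ T = T' ∘ φ`: `⋁ T^{-i}(φ⁻¹ξ') = φ⁻¹(⋁ T'^{-i} ξ')`.
[cite: Walters1982, Thm 4.11 (proof)] -/
theorem itinerary_comp_of_semiconj {φ : Ω → Ω'} {T' : Ω' → Ω'} (h : Semiconj φ T T')
    (ξ' : Ω' → α) (n : ℕ) : itinerary T (ξ' ∘ φ) n = itinerary T' ξ' n ∘ φ := by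
  funext ω i
  simp only [itinerary_apply, comp_apply, (h.iterate_right i).eq]

end ItineraryAlgebra

/-! ### Walters Thm 4.12 (vi) and `h(id) = 0` -/

section Thm412vi

variable [Fintype α] [MeasurableSpace α] [MeasurableSingletonClass α] {mΩ : MeasurableSpace Ω}
  {μ : Measure Ω} [IsProbabilityMeasure μ] {T : Ω → Ω} {ξ : Ω → α}

/-- `h(id, ξ) = 0` for every finite partition (Walters: `h(id_X) = 0`).
[cite: Walters1982, §4.4 Remark (2) after Def 4.10] -/
theorem dynEntropy_id (hξ : Measurable ξ) : dynEntropy μ id ξ = 0 := by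
  refine le_antisymm ?_ (dynEntropy_nonneg _ _)
  have hlim : Tendsto (fun n : ℕ => partitionEntropy μ ξ / ((n + 1 : ℕ) : ℝ)) atTop (𝓝 0) :=
    (tendsto_const_div_atTop_nhds_zero_nat _).comp (tendsto_add_atTop_nat 1)
  refine ge_of_tendsto' hlim fun n => ?_
  calc dynEntropy μ id ξ ≤ partitionEntropy μ (itinerary id ξ (n + 1)) / ((n + 1 : ℕ) : ℝ) :=
        dynEntropy_le_partitionEntropy_itinerary_div _ _ (Nat.succ_ne_zero n)
    _ ≤ partitionEntropy μ ξ / ((n + 1 : ℕ) : ℝ) := by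
        rw [itinerary_id]
        exact div_le_div_of_nonneg_right (partitionEntropy_comp_le hξ _) (by positivity)

/-- `h(T⁰, ξ) = h(id, ξ) = 0`. [cite: Walters1982, §4.4 Remark (2) after Def 4.10] -/
theorem dynEntropy_iterate_zero (hξ : Measurable ξ) : dynEntropy μ T^[0] ξ = 0 :=
  dynEntropy_id hξ

/-- **Walters Thm 4.12 (vi)**: `h(T, ⋁_{i<k} T^{-i}ξ) = h(T, ξ)` for `k ≥ 1`: the sequence
`(1/n) H(⋁_{j<n} T^{-j} ⋁_{i<k} T^{-i}ξ)` is squeezed between `(1/n) Hₙ` and `(1/n) H_{n+k}`.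
[cite: Walters1982, Thm 4.12 (vi)] -/
theorem dynEntropy_itinerary (hT : MeasurePreserving T μ μ) (hξ : Measurable ξ) {k : ℕ}
    (hk : k ≠ 0) : dynEntropy μ T (itinerary T ξ k) = dynEntropy μ T ξ := by
  obtain ⟨k, rfl⟩ := Nat.exists_eq_succ_of_ne_zero hk
  have hξk : Measurable (itinerary T ξ (k + 1)) := measurable_itinerary hT.measurable hξ _
  -- the three sequences
  have hA := tendsto_partitionEntropy_itinerary_div hT hξk
  have hlow := tendsto_partitionEntropy_itinerary_div hT hξ
  have hup : Tendsto (fun n : ℕ => (1 + (k + 1 : ℝ) / n) *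
      (partitionEntropy μ (itinerary T ξ (n + (k + 1))) / ((n + (k + 1) : ℕ) : ℝ))) atTop
      (𝓝 (dynEntropy μ T ξ)) := by
    have h1 : Tendsto (fun n : ℕ => 1 + (k + 1 : ℝ) / n) atTop (𝓝 1) := by
      simpa using tendsto_const_nhds.add (tendsto_const_div_atTop_nhds_zero_nat (k + 1 : ℝ))
    simpa using h1.mul (hlow.comp (tendsto_add_atTop_nat (k + 1)))
  refine tendsto_nhds_unique hA (tendsto_of_tendsto_of_tendsto_of_le_of_le' hlow hup ?_ ?_)
  · filter_upwards with n
    refine div_le_div_of_nonneg_right ?_ n.cast_nonneg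
    conv_lhs => rw [itinerary_eq_comp_itinerary_itinerary T ξ k n]
    exact partitionEntropy_comp_le (measurable_itinerary hT.measurable hξk n) _
  · filter_upwards [eventually_ne_atTop 0] with n hn
    have hn' : (n : ℝ) ≠ 0 := Nat.cast_ne_zero.2 hn
    have hnk : ((n + (k + 1) : ℕ) : ℝ) ≠ 0 := Nat.cast_ne_zero.2 (by omega)
    calc partitionEntropy μ (itinerary T (itinerary T ξ (k + 1)) n) / n
        ≤ partitionEntropy μ (itinerary T ξ (n + (k + 1))) / n := by
          refine div_le_div_of_nonneg_right ?_ n.cast_nonneg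
          rw [itinerary_itinerary_eq_comp]
          exact partitionEntropy_comp_le (measurable_itinerary hT.measurable hξ _) _
      _ = (1 + (k + 1 : ℝ) / n) *
          (partitionEntropy μ (itinerary T ξ (n + (k + 1))) / ((n + (k + 1) : ℕ) : ℝ)) := by
          push_cast
          field_simp

end Thm412vi

/-! ### Walters Thm 4.13 (i): `h(Tᵏ) = k h(T)` -/

section Thm413

variable [Fintype α] [MeasurableSpace α] [MeasurableSingletonClass α] {mΩ : MeasurableSpace Ω}
  {μ : Measure Ω} [IsProbabilityMeasure μ] {T : Ω → Ω} {ξ : Ω → α}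

/-- `H(⋁_{j<n} T^{-kj} ⋁_{i<k} T^{-i}ξ) = H(⋁_{l<nk} T^{-l}ξ)` (the two partitions coincide).
[cite: Walters1982, Thm 4.13 (i) (proof)] -/
theorem partitionEntropy_itinerary_iterate_itinerary (hT : Measurable T) (hξ : Measurable ξ)
    {k : ℕ} (hk : 0 < k) (n : ℕ) :
    partitionEntropy μ (itinerary T^[k] (itinerary T ξ k) n) =
      partitionEntropy μ (itinerary T ξ (n * k)) := by
  refine le_antisymm ?_ ?_
  · rw [itinerary_iterate_itinerary_eq_comp]
    exact partitionEntropy_comp_le (measurable_itinerary hT hξ _) _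
  · conv_lhs => rw [itinerary_mul_eq_comp T ξ hk n]
    exact partitionEntropy_comp_le
      (measurable_itinerary (hT.iterate k) (measurable_itinerary hT hξ k) n) _

/-- `h(Tᵏ, ⋁_{i<k} T^{-i}ξ) = k h(T, ξ)` (Walters, first display in the proof of Thm 4.13; true
for `k = 0` as `0 = 0`). [cite: Walters1982, Thm 4.13 (i) (proof)] -/
theorem dynEntropy_iterate_itinerary (hT : MeasurePreserving T μ μ) (hξ : Measurable ξ) (k : ℕ) :
    dynEntropy μ T^[k] (itinerary T ξ k) = k * dynEntropy μ T ξ := by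
  rcases Nat.eq_zero_or_pos k with rfl | hk
  · rw [Nat.cast_zero, zero_mul]
    exact dynEntropy_iterate_zero (measurable_itinerary hT.measurable hξ 0)
  have hξk : Measurable (itinerary T ξ k) := measurable_itinerary hT.measurable hξ k
  have hA := tendsto_partitionEntropy_itinerary_div (hT.iterate k) hξk
  have hB : Tendsto
      (fun n : ℕ => partitionEntropy μ (itinerary T ξ (n * k)) / ((n * k : ℕ) : ℝ) * k) atTop
      (𝓝 (dynEntropy μ T ξ * k)) :=
    ((tendsto_partitionEntropy_itinerary_div hT hξ).comp
      (tendsto_atTop_mono (fun n => Nat.le_mul_of_pos_right n hk) tendsto_id)).mul_const _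
  rw [mul_comm]
  refine tendsto_nhds_unique hA (hB.congr fun n => ?_)
  have hk' : (k : ℝ) ≠ 0 := Nat.cast_ne_zero.2 hk.ne'
  rw [partitionEntropy_itinerary_iterate_itinerary hT.measurable hξ hk, Nat.cast_mul,
    div_mul_eq_mul_div, mul_div_mul_right _ _ hk']

/-- `h(id) = 0` (Walters, Remark (2) after Def 4.10). [cite: Walters1982, §4.4 Remark (2)] -/
theorem kolmogorovSinaiEntropy_id (μ : Measure Ω) [IsProbabilityMeasure μ] :
    kolmogorovSinaiEntropy μ id = 0 := by
  refine le_antisymm ((kolmogorovSinaiEntropy_le_iff μ id 0).2 fun j ξ hξ => ?_) bot_le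
  rw [dynEntropy_id hξ, ENNReal.ofReal_zero]

/-- **Walters Thm 4.13 (i)**: `h(Tᵏ) = k h(T)` for a measure-preserving `T` (`k : ℕ`; for
`k = 0` both sides vanish, `h(id) = 0`). [cite: Walters1982, Thm 4.13 (i)] -/
theorem kolmogorovSinaiEntropy_iterate (hT : MeasurePreserving T μ μ) (k : ℕ) :
    kolmogorovSinaiEntropy μ T^[k] = k * kolmogorovSinaiEntropy μ T := by
  rcases Nat.eq_zero_or_pos k with rfl | hk
  · rw [Nat.cast_zero, zero_mul, iterate_zero]
    exact kolmogorovSinaiEntropy_id μ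
  refine le_antisymm ?_ ?_
  · -- `h(Tᵏ, ξ) ≤ h(Tᵏ, ⋁_{i<k} T^{-i}ξ) = k h(T, ξ) ≤ k h(T)`
    refine (kolmogorovSinaiEntropy_le_iff μ _ _).2 fun j ξ hξ => ?_
    obtain ⟨k', rfl⟩ := Nat.exists_eq_succ_of_ne_zero hk.ne'
    have hξk : Measurable (itinerary T ξ (k' + 1)) := measurable_itinerary hT.measurable hξ _
    calc ENNReal.ofReal (dynEntropy μ T^[k' + 1] ξ)
        ≤ ENNReal.ofReal (dynEntropy μ T^[k' + 1] (itinerary T ξ (k' + 1))) := by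
          refine ENNReal.ofReal_le_ofReal ?_
          conv_lhs => rw [← comp_itinerary_succ_eval_zero T ξ k']
          exact dynEntropy_comp_le (hT.measurable.iterate _) hξk _
      _ = (k' + 1 : ℕ) * ENNReal.ofReal (dynEntropy μ T ξ) := by
          rw [dynEntropy_iterate_itinerary hT hξ, ENNReal.ofReal_mul (Nat.cast_nonneg _),
            ENNReal.ofReal_natCast]
      _ ≤ (k' + 1 : ℕ) * kolmogorovSinaiEntropy μ T := by
          gcongr
          exact ofReal_dynEntropy_le_kolmogorovSinaiEntropy μ T hξ
  · -- `k h(T) = sup_ξ k h(T, ξ) = sup_ξ h(Tᵏ, ⋁_{i<k} T^{-i}ξ) ≤ h(Tᵏ)`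
    rw [kolmogorovSinaiEntropy_def μ T, ENNReal.mul_iSup]
    refine iSup_le fun j => ?_
    rw [ENNReal.mul_iSup]
    refine iSup_le fun ξ => ?_
    rw [ENNReal.mul_iSup]
    refine iSup_le fun hξ => ?_
    rw [← ENNReal.ofReal_natCast, ← ENNReal.ofReal_mul (Nat.cast_nonneg _),
      ← dynEntropy_iterate_itinerary hT hξ]
    exact ofReal_dynEntropy_le_kolmogorovSinaiEntropy μ _
      (measurable_itinerary hT.measurable hξ k)

end Thm413

/-! ### Walters Thm 4.11: conjugacy invariance; factors -/

section Thm411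

variable [Fintype α] [MeasurableSpace α] [MeasurableSingletonClass α] {mΩ : MeasurableSpace Ω}
  {mΩ' : MeasurableSpace Ω'} {μ : Measure Ω} {μ' : Measure Ω'} {T : Ω → Ω} {T' : Ω' → Ω'}
  {φ : Ω → Ω'}

/-- Along a measure-preserving semiconjugacy `φ ∘ T = T' ∘ φ` the joins have the same entropy:
`H_μ(⋁ T^{-i} φ⁻¹ξ') = H_{μ'}(⋁ T'^{-i} ξ')` (the computation in the proof of Walters Thm 4.11).
[cite: Walters1982, Thm 4.11 (proof)] -/
theorem partitionEntropy_itinerary_comp_of_semiconj (hφ : MeasurePreserving φ μ μ')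
    (h : Semiconj φ T T') (hT' : Measurable T') {ξ' : Ω' → α} (hξ' : Measurable ξ') (n : ℕ) :
    partitionEntropy μ (itinerary T (ξ' ∘ φ) n) = partitionEntropy μ' (itinerary T' ξ' n) := by
  rw [itinerary_comp_of_semiconj T h]
  exact partitionEntropy_comp_of_measurePreserving hφ (measurable_itinerary hT' hξ' n)

/-- `h_μ(T, φ⁻¹ξ') = h_{μ'}(T', ξ')` along a measure-preserving semiconjugacy
(Walters: "`h(T₁, 𝒜₁) = h(T₂, 𝒜₂)`" in the proof of Thm 4.11).
[cite: Walters1982, Thm 4.11 (proof)] -/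
theorem dynEntropy_comp_of_semiconj (hφ : MeasurePreserving φ μ μ') (h : Semiconj φ T T')
    (hT' : Measurable T') {ξ' : Ω' → α} (hξ' : Measurable ξ') :
    dynEntropy μ T (ξ' ∘ φ) = dynEntropy μ' T' ξ' := by
  unfold dynEntropy
  exact iInf_congr fun n => by rw [partitionEntropy_itinerary_comp_of_semiconj hφ h hT' hξ']

/-- **A factor has no more entropy** (Walters, sentence after the proof of Thm 4.11; Downarowicz
Fact 4.1.3): if `φ : (Ω, μ) → (Ω', μ')` is measure-preserving and `φ ∘ T = T' ∘ φ`, then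
`h_{μ'}(T') ≤ h_μ(T)`. [cite: Walters1982, Thm 4.11] -/
theorem kolmogorovSinaiEntropy_le_of_semiconj (hφ : MeasurePreserving φ μ μ')
    (h : Semiconj φ T T') (hT' : Measurable T') :
    kolmogorovSinaiEntropy μ' T' ≤ kolmogorovSinaiEntropy μ T := by
  refine (kolmogorovSinaiEntropy_le_iff μ' T' _).2 fun j ξ' hξ' => ?_
  rw [← dynEntropy_comp_of_semiconj hφ h hT' hξ']
  exact ofReal_dynEntropy_le_kolmogorovSinaiEntropy μ T (hξ'.comp hφ.measurable)

/-- **Walters Thm 4.11 (entropy is a conjugacy invariant)**, point-map form: if measure-preserving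
maps `φ : (Ω, μ) → (Ω', μ')`, `ψ : (Ω', μ') → (Ω, μ)` intertwine `T` and `T'`
(`φ ∘ T = T' ∘ φ`, `ψ ∘ T' = T ∘ ψ`), then `h_μ(T) = h_{μ'}(T')`. [cite: Walters1982, Thm 4.11] -/
theorem kolmogorovSinaiEntropy_eq_of_semiconj {ψ : Ω' → Ω} (hφ : MeasurePreserving φ μ μ')
    (hψ : MeasurePreserving ψ μ' μ) (h : Semiconj φ T T') (h' : Semiconj ψ T' T)
    (hT : Measurable T) (hT' : Measurable T') :
    kolmogorovSinaiEntropy μ T = kolmogorovSinaiEntropy μ' T' :=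
  le_antisymm (kolmogorovSinaiEntropy_le_of_semiconj hψ h' hT)
    (kolmogorovSinaiEntropy_le_of_semiconj hφ h hT')

end Thm411

end Literature.Dynamics.Ergodic
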